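import Summits.Ventures.CertifiedManyBodySolver.Observables.ThermalFluxZeeman
import HarnessLib

/-!
# Ventures/CertifiedManyBodySolver — Observables/StiffnessThermalLeafZeeman.lean

HONEST FRAMING: one-sided kinematic (one-body) CEILINGS on the THERMAL uniform flux stiffness of the strictly two-dimensional one-band
`t–t′` Hubbard torus at EVERY uniform Zeeman field `h` (canonical particle number, all `S^z` sectors weighted by `e^{βh S^z}`) and the
Kosterlitz–Thouless-type UPPER bound on a transition temperature they give, CONDITIONAL on the named KT inputs carried at field `h`;
a ceiling never speaks to the presence of order; not a `T_c` estimate, not a superconductivity verdict; a MATERIAL ceiling only through a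
separately stated 2D → 3D transfer assumption. The ORBITAL coupling of a field is NOT treated.

Cell `hubbard-tc` (MO-S3 ORDER → `T_c` back-end, D-0096; output continuum `T × P × H`, D-0099/D-0100), seat p1, `prover-hubbard-tc-p1-g5-0`;
the Zeeman twin of `StiffnessThermalLeaf` (key K1t) on the finite-torus bounds of `ThermalFluxZeeman`:

* §4 the sequence-robust leaf `ObsThermalStiffnessSeqCeilingZeemanAt tp U n c` («every `β > 0`, EVERY `h`, every `L_j → ∞`: a thermal flux
  stiffness of the Zeeman ensemble is `≤ c`»), the half-bathtub hook `…_of_halfBathtub_le` (any real level `ν`), the unconditional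
  `t′ = 0` leaf `c ≥ 4/π²`, and the three box transports of `StiffnessHalfBathtubBox` / `StiffnessHalfBathtubParticleHole` (top-filling
  corners `ν ≥ 0`; bottom-filling corners `ν ≤ 0`; particle–hole image box) — so EVERY landed corner certificate of the cell
  (`Certificates/HubbardSquare_*BoxE_*_corner₁/₂_le`) yields its constant at every Zeeman field in one line;
* §5 the field-`h` thermal KT dictionary `ThermalKTDictionaryZeemanAt tp U n h ρₑ Tc` (K2 stability + K1t identification with the
  field-`h` ensemble; every field a HYPOTHESIS, exactly as at `h = 0`) and `Tc ≤ (π/4)·c` from the Zeeman leaf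
  (`ThermalKTDictionaryZeemanAt.le_pi_div_four_mul`); the K3-free family row `Tc ≤ 1/π` at `t′ = 0`, every `U`, `n`, `h`.

What this does NOT say: nothing about the orbital effect of a field, vortices, `H_{c2}`, or whether the NK closure is physically adequate
in a field (the cell's ASSUMPTIONS §2 AXES keeps K2 as a zero-field RG statement; here it is a named hypothesis with `h` as a parameter).

References: A. Paramekanti, N. Trivedi, M. Randeria, PRB 57 (1998) 11639, eq. (3), §IV [ParamekantiTrivediRanderia1998]; T. Hazra,
N. Verma, M. Randeria, PRX 9 (2019) 031049, eqs. (2)–(6), App. G [HazraVermaRanderia2019]; D. J. Scalapino, S. R. White, S. Zhang,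
PRB 47 (1993) 7995, §II [ScalapinoWhiteZhang1993]; D. R. Nelson, J. M. Kosterlitz, PRL 39 (1977) 1201 [NelsonKosterlitz1977].
-/

noncomputable section


namespace Summit.Ventures.CertifiedManyBodySolver.Observables

open Filter Topology Set Real MeasureTheory Matrix
open Literature.MathematicalPhysics.QuantumLattice
open Literature.MathematicalPhysics.QuantumFieldTheory
open Literature.Probability.LatticeModels
open Literature.MathematicalPhysics.StatisticalMechanics
open Literature.MathematicalPhysics.StatisticalMechanics.KosterlitzThouless
open Summit.HubbardSuperconductivity.HubbardLadder.Bounds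
open scoped ComplexConjugate ComplexOrder

variable {L : ℕ}

/-! ## §4 The Zeeman thermal leaf, its half-bathtub hook and the box transports -/

/-- **Thermal sequence-robust stiffness ceiling `c` at the anchor `(U, n, t′)`, EVERY Zeeman field** (key K1t-h). For EVERY `β > 0`,
EVERY field `h`, every sequence of sides `L_j → ∞` and every `ρ_s > 0` (scale `θ₀ > 0`) with
`βρ_sθ² ≤ log Z_h,L_j(0) − log Z_h,L_j(θ)` (`|θ| ≤ θ₀`; `log Z_h,L = thermalFluxLogZZeeman L tp U (1 − n) β h`) at every side of the
sequence, `ρ_s ≤ c` (tree units, `t = 1`). [cite: ScalapinoWhiteZhang1993, §II] -/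
def ObsThermalStiffnessSeqCeilingZeemanAt (tp U n : ℝ) (c : ℚ) : Prop :=
  ∀ (β h ρs θ₀ : ℝ), 0 < β → 0 < ρs → 0 < θ₀ → ∀ Ls : ℕ → ℕ, Tendsto Ls atTop atTop →
    (∀ (j : ℕ) [NeZero (Ls j)] (θ : ℝ), |θ| ≤ θ₀ →
      β * ρs * θ ^ 2 ≤ thermalFluxLogZZeeman (Ls j) tp U (1 - n) β h 0 -
        thermalFluxLogZZeeman (Ls j) tp U (1 - n) β h θ) →
    ρs ≤ ((c : ℚ) : ℝ)

/-- Monotone transport of the Zeeman leaf. [cite: ScalapinoWhiteZhang1993, §II] -/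
theorem ObsThermalStiffnessSeqCeilingZeemanAt.mono {tp U n : ℝ} {c c' : ℚ} (h : ObsThermalStiffnessSeqCeilingZeemanAt tp U n c)
    (hcc : c ≤ c') : ObsThermalStiffnessSeqCeilingZeemanAt tp U n c' :=
  fun β hh ρs θ₀ hβ hρs hθ₀ Ls hLs hst => (h β hh ρs θ₀ hβ hρs hθ₀ Ls hLs hst).trans (by exact_mod_cast hcc)

/-- **The half-bathtub ceiling along a sequence of sides, every Zeeman field**: under the hypotheses of the leaf (`0 ≤ n ≤ 2`), for every
`ν`, `ρ_s ≤ ν·n/2 + (4π²)⁻¹∫∫(cos x + cos y + 4t′cos x cos y − ν)⁺` (finite-side bound + rate `→ 0`).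
[cite: ParamekantiTrivediRanderia1998, eq. (3) and §IV] -/
theorem zeemanFluxStiffness_le_halfBathtub_seq (tp U n : ℝ) (hn0 : 0 ≤ n) (hn2 : n ≤ 2) {β h ρs θ₀ : ℝ} (hβ : 0 < β)
    (hρs : 0 < ρs) (hθ₀ : 0 < θ₀) {Ls : ℕ → ℕ} (hLs : Tendsto Ls atTop atTop)
    (hst : ∀ (j : ℕ) [NeZero (Ls j)] (θ : ℝ), |θ| ≤ θ₀ →
      β * ρs * θ ^ 2 ≤ thermalFluxLogZZeeman (Ls j) tp U (1 - n) β h 0 -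
        thermalFluxLogZZeeman (Ls j) tp U (1 - n) β h θ) (ν : ℝ) :
    ρs ≤ ν * n / 2 +
      (∫ y in (-π)..π, ∫ x in (-π)..π,
          max (Real.cos x + Real.cos y + 4 * tp * (Real.cos x * Real.cos y) - ν) 0) / (4 * π ^ 2) := by
  have hev : ∀ᶠ j in atTop, ρs ≤ ν * n / 2 +
      (∫ y in (-π)..π, ∫ x in (-π)..π,
          max (Real.cos x + Real.cos y + 4 * tp * (Real.cos x * Real.cos y) - ν) 0) / (4 * π ^ 2) +
        (|ν| + 2 * π * (1 + 4 * |tp|)) / ((Ls j : ℕ) : ℝ) := by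
    filter_upwards [hLs.eventually_ge_atTop 3] with j hj
    haveI : NeZero (Ls j) := ⟨by omega⟩
    have h := zeemanStiffness_le_halfBathtub (L := Ls j) hj tp U h (δ := 1 - n) (by linarith) (by linarith) hβ hρs hθ₀
      (hst j) ν
    have hνn : ν * (1 - (1 - n)) / 2 = ν * n / 2 := by ring
    rw [hνn] at h
    exact h
  have hrate : Tendsto (fun j => (|ν| + 2 * π * (1 + 4 * |tp|)) / ((Ls j : ℕ) : ℝ)) atTop (𝓝 0) :=
    tendsto_const_nhds.div_atTop (tendsto_natCast_atTop_atTop.comp hLs)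
  have hlim : Tendsto (fun j => ν * n / 2 +
      (∫ y in (-π)..π, ∫ x in (-π)..π,
          max (Real.cos x + Real.cos y + 4 * tp * (Real.cos x * Real.cos y) - ν) 0) / (4 * π ^ 2) +
        (|ν| + 2 * π * (1 + 4 * |tp|)) / ((Ls j : ℕ) : ℝ)) atTop
      (𝓝 (ν * n / 2 +
        (∫ y in (-π)..π, ∫ x in (-π)..π,
          max (Real.cos x + Real.cos y + 4 * tp * (Real.cos x * Real.cos y) - ν) 0) / (4 * π ^ 2) + 0)) :=
    tendsto_const_nhds.add hrate
  rw [add_zero] at hlim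
  exact ge_of_tendsto hlim hev

/-- **Hook for a certified evaluation, every Zeeman field**: `ν·n/2 + B(t′, ν) ≤ c` (`0 ≤ n ≤ 2`, any `t′`, `U`, any real `ν`) ⇒
`ObsThermalStiffnessSeqCeilingZeemanAt tp U n c`. [cite: ParamekantiTrivediRanderia1998, eq. (3) and §IV] -/
theorem ObsThermalStiffnessSeqCeilingZeemanAt_of_halfBathtub_le (tp U n : ℝ) (hn0 : 0 ≤ n) (hn2 : n ≤ 2) (ν : ℝ) (c : ℚ)
    (hc : ν * n / 2 +
      (∫ y in (-π)..π, ∫ x in (-π)..π,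
          max (Real.cos x + Real.cos y + 4 * tp * (Real.cos x * Real.cos y) - ν) 0) / (4 * π ^ 2) ≤ ((c : ℚ) : ℝ)) :
    ObsThermalStiffnessSeqCeilingZeemanAt tp U n c :=
  fun _β _h _ρs _θ₀ hβ hρs hθ₀ _Ls hLs hst =>
    (zeemanFluxStiffness_le_halfBathtub_seq tp U n hn0 hn2 hβ hρs hθ₀ hLs hst ν).trans hc

/-- **THE THERMAL KINEMATIC LEAF AT EVERY ZEEMAN FIELD, UNCONDITIONAL** (`t′ = 0`, any `U`, `0 ≤ n ≤ 2`, every temperature, every `h`):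
`ObsThermalStiffnessSeqCeilingZeemanAt 0 U n c` for every `c ≥ 4/π²`. [cite: HazraVermaRanderia2019, App. G] -/
theorem ObsThermalStiffnessSeqCeilingZeemanAt_tp0_kinematic {U n : ℝ} (hn0 : 0 ≤ n) (hn2 : n ≤ 2) (c : ℚ)
    (hc : 4 / Real.pi ^ 2 ≤ ((c : ℚ) : ℝ)) : ObsThermalStiffnessSeqCeilingZeemanAt 0 U n c := by
  refine ObsThermalStiffnessSeqCeilingZeemanAt_of_halfBathtub_le 0 U n hn0 hn2 0 c ?_
  have hI : (∫ y in (-π)..π, ∫ x in (-π)..π,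
      max (Real.cos x + Real.cos y + 4 * (0 : ℝ) * (Real.cos x * Real.cos y) - 0) 0) = π ^ 2 * kinL1 0 :=
    bzInt_bathtubSymbolTT'_zero 0
  rw [hI, kinL1_zero]
  have hπ : (π : ℝ) ≠ 0 := Real.pi_ne_zero
  have e : (0 : ℝ) * n / 2 + π ^ 2 * (16 / π ^ 2) / (4 * π ^ 2) = 4 / π ^ 2 := by
    field_simp
    ring
  rw [e]
  exact hc

/-- **Top-filling corner certificates (`ν₁, ν₂ ≥ 0`) ⇒ the Zeeman leaf on the box** `t′ ∈ [t′₁, t′₂]`, `0 ≤ n ≤ n₂ ≤ 2`, every `U`, every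
field. [cite: HazraVermaRanderia2019, eqs. (2)-(6)] -/
theorem ObsThermalStiffnessSeqCeilingZeemanAt_box_of_corners_le {t₁ t₂ ν₁ ν₂ n₂ : ℝ} (hν₁ : 0 ≤ ν₁) (hν₂ : 0 ≤ ν₂)
    (hn₂ : n₂ ≤ 2) (c : ℚ)
    (h₁ : ν₁ * n₂ / 2 +
      (∫ y in (-π)..π, ∫ x in (-π)..π, max (Real.cos x + Real.cos y + 4 * t₁ * (Real.cos x * Real.cos y) - ν₁) 0) /
        (4 * π ^ 2) ≤ ((c : ℚ) : ℝ))
    (h₂ : ν₂ * n₂ / 2 +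
      (∫ y in (-π)..π, ∫ x in (-π)..π, max (Real.cos x + Real.cos y + 4 * t₂ * (Real.cos x * Real.cos y) - ν₂) 0) /
        (4 * π ^ 2) ≤ ((c : ℚ) : ℝ))
    {tp U n : ℝ} (htp : tp ∈ Icc t₁ t₂) (hn0 : 0 ≤ n) (hn : n ≤ n₂) :
    ObsThermalStiffnessSeqCeilingZeemanAt tp U n c := by
  obtain ⟨ν, _, hν⟩ := halfBathtub_box_le hν₁ hν₂ h₁ h₂ htp hn
  exact ObsThermalStiffnessSeqCeilingZeemanAt_of_halfBathtub_le tp U n hn0 (hn.trans hn₂) ν c hν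

/-- **Bottom-filling corner certificates (`ν₁, ν₂ ≤ 0`) ⇒ the Zeeman leaf on the electron-side box** `t′ ∈ [t′₁, t′₂]`, `n₁ ≤ n ≤ 2`
(`0 ≤ n₁`), every `U`, every field. [cite: HazraVermaRanderia2019, eqs. (2)-(6)] -/
theorem ObsThermalStiffnessSeqCeilingZeemanAt_box_of_corners_le_of_nonpos {t₁ t₂ ν₁ ν₂ n₁ : ℝ} (hν₁ : ν₁ ≤ 0) (hν₂ : ν₂ ≤ 0)
    (hn₁ : 0 ≤ n₁) (c : ℚ)
    (h₁ : ν₁ * n₁ / 2 +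
      (∫ y in (-π)..π, ∫ x in (-π)..π, max (Real.cos x + Real.cos y + 4 * t₁ * (Real.cos x * Real.cos y) - ν₁) 0) /
        (4 * π ^ 2) ≤ ((c : ℚ) : ℝ))
    (h₂ : ν₂ * n₁ / 2 +
      (∫ y in (-π)..π, ∫ x in (-π)..π, max (Real.cos x + Real.cos y + 4 * t₂ * (Real.cos x * Real.cos y) - ν₂) 0) /
        (4 * π ^ 2) ≤ ((c : ℚ) : ℝ))
    {tp U n : ℝ} (htp : tp ∈ Icc t₁ t₂) (hn : n₁ ≤ n) (hn2 : n ≤ 2) :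
    ObsThermalStiffnessSeqCeilingZeemanAt tp U n c := by
  obtain ⟨ν, _, hν⟩ := halfBathtub_box_le_of_nonpos hν₁ hν₂ h₁ h₂ htp hn
  exact ObsThermalStiffnessSeqCeilingZeemanAt_of_halfBathtub_le tp U n (hn₁.trans hn) hn2 ν c hν

/-- **Hole-side top-filling corners ⇒ the Zeeman leaf on the particle–hole IMAGE box** `t′ ∈ [−t′₂, −t′₁]`, `2 − n₂ ≤ n ≤ 2`, every `U`,
every field (`halfBathtub_corner_particleHole`). [cite: HazraVermaRanderia2019, eqs. (2)-(6)] -/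
theorem ObsThermalStiffnessSeqCeilingZeemanAt_imageBox_of_corners_le {t₁ t₂ ν₁ ν₂ n₂ : ℝ} (hν₁ : 0 ≤ ν₁) (hν₂ : 0 ≤ ν₂)
    (hn₂ : n₂ ≤ 2) (c : ℚ)
    (h₁ : ν₁ * n₂ / 2 +
      (∫ y in (-π)..π, ∫ x in (-π)..π, max (Real.cos x + Real.cos y + 4 * t₁ * (Real.cos x * Real.cos y) - ν₁) 0) /
        (4 * π ^ 2) ≤ ((c : ℚ) : ℝ))
    (h₂ : ν₂ * n₂ / 2 +
      (∫ y in (-π)..π, ∫ x in (-π)..π, max (Real.cos x + Real.cos y + 4 * t₂ * (Real.cos x * Real.cos y) - ν₂) 0) /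
        (4 * π ^ 2) ≤ ((c : ℚ) : ℝ))
    {tp U n : ℝ} (htp : tp ∈ Icc (-t₂) (-t₁)) (hn : 2 - n₂ ≤ n) (hn2 : n ≤ 2) :
    ObsThermalStiffnessSeqCeilingZeemanAt tp U n c :=
  ObsThermalStiffnessSeqCeilingZeemanAt_box_of_corners_le_of_nonpos (t₁ := -t₂) (t₂ := -t₁) (ν₁ := -ν₂) (ν₂ := -ν₁)
    (n₁ := 2 - n₂) (neg_nonpos.mpr hν₂) (neg_nonpos.mpr hν₁) (sub_nonneg.mpr hn₂) c
    (halfBathtub_corner_particleHole h₂) (halfBathtub_corner_particleHole h₁) htp hn hn2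

/-! ## §5 The field-`h` thermal KT dictionary and `T_c ≤ (π/4)·c` at every Zeeman field -/

/-- **Thermal identification at inverse temperature `β` and Zeeman field `h` (key K1t-h).** `ρ` is (at most) a thermal uniform flux
stiffness constant of the field-`h` canonical ensemble of `hubbardTorusTT' L 1 tp U` in the sequence-robust sense of the Zeeman leaf:
every level `0 < r < ρ` satisfies `βrθ² ≤ log Z_h,L_j(0) − log Z_h,L_j(θ)` for `|θ| ≤ θ₀` along some `L_j → ∞`. A HYPOTHESIS on the
profile. [cite: ScalapinoWhiteZhang1993, §II] -/
def IsThermalFluxStiffnessZeemanSeqAt (tp U n β h ρ : ℝ) : Prop :=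
  ∀ r : ℝ, 0 < r → r < ρ → ∃ θ₀ : ℝ, 0 < θ₀ ∧ ∃ Ls : ℕ → ℕ, Tendsto Ls atTop atTop ∧
    ∀ (j : ℕ) [NeZero (Ls j)] (θ : ℝ), |θ| ≤ θ₀ →
      β * r * θ ^ 2 ≤ thermalFluxLogZZeeman (Ls j) tp U (1 - n) β h 0 - thermalFluxLogZZeeman (Ls j) tp U (1 - n) β h θ

/-- **Zeeman leaf + identification ⇒ the identified level is below the ceiling.** [cite: ScalapinoWhiteZhang1993, §II] -/
theorem IsThermalFluxStiffnessZeemanSeqAt.le_of_leaf {tp U n β h ρ : ℝ} {c : ℚ} (hρ : IsThermalFluxStiffnessZeemanSeqAt tp U n β h ρ)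
    (hβ : 0 < β) (hρ0 : 0 < ρ) (hleaf : ObsThermalStiffnessSeqCeilingZeemanAt tp U n c) : ρ ≤ ((c : ℚ) : ℝ) := by
  have hr : ∀ r : ℝ, 0 < r → r < ρ → r ≤ ((c : ℚ) : ℝ) := by
    intro r hr0 hrρ
    obtain ⟨θ₀, hθ₀, Ls, hLs, hst⟩ := hρ r hr0 hrρ
    exact hleaf β h r θ₀ hβ hr0 hθ₀ Ls hLs hst
  have hc : 0 < ((c : ℚ) : ℝ) := lt_of_lt_of_le (half_pos hρ0) (hr _ (half_pos hρ0) (half_lt_self hρ0))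
  refine le_of_forall_lt_imp_le_of_dense fun r hrρ => ?_
  rcases le_or_gt r 0 with hr0 | hr0
  · exact hr0.trans hc.le
  · exact hr r hr0 hrρ

/-- **The monotonicity-free KT dictionary at the anchor `(U, n, t′)` IN THE ZEEMAN FIELD `h`** for a thermal electron twist-coefficient
profile `ρₑ` and a candidate transition temperature `Tc`: `pos` (`0 < Tc`), `stable` (K2: `(2/π)T ≤ ρₑ(T)/2` on `(0, Tc)` — the
Nelson–Kosterlitz stability hypothesis, here ASSUMED at field `h` exactly as at `h = 0`; a pure Zeeman coupling creates no vortices, but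
this is an RG hypothesis either way), `thermal` (K1t-h: `ρₑ(T)` identified with a thermal flux stiffness of the field-`h` ensemble at
`β = 1/T`). Every field is a HYPOTHESIS. [cite: HazraVermaRanderia2019, eqs. (2)–(3)] -/
structure ThermalKTDictionaryZeemanAt (tp U n h : ℝ) (ρe : ℝ → ℝ) (Tc : ℝ) : Prop where
  /-- `0 < Tc`. -/
  pos : 0 < Tc
  /-- K2: KT stability inequality for the pair stiffness `ρₑ/2` below `Tc`, at field `h`. -/
  stable : StableBelow (fun T => phaseStiffnessOfTwistCoeff 2 (ρe T)) Tc
  /-- K1t-h: at every `T ∈ (0, Tc)`, `ρₑ(T)` is a thermal flux-stiffness constant of the field-`h` ensemble at `β = 1/T`. -/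
  thermal : ∀ ⦃T : ℝ⦄, 0 < T → T < Tc → IsThermalFluxStiffnessZeemanSeqAt tp U n (1 / T) h (ρe T)

namespace ThermalKTDictionaryZeemanAt

variable {tp U n h : ℝ} {ρe : ℝ → ℝ} {Tc : ℝ}

/-- Under the dictionary the profile is positive below `Tc`. [cite: NelsonKosterlitz1977, eq. (1)] -/
theorem apply_pos (hd : ThermalKTDictionaryZeemanAt tp U n h ρe Tc) {T : ℝ} (hT : 0 < T) (hTTc : T < Tc) : 0 < ρe T := by
  have h1 : 2 / π * T ≤ phaseStiffnessOfTwistCoeff 2 (ρe T) := hd.stable hT hTTc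
  rw [phaseStiffnessOfTwistCoeff_two] at h1
  have h2 : 0 < 2 / π * T := by positivity
  linarith

/-- Under the dictionary, a Zeeman leaf bounds the profile throughout `(0, Tc)`. [cite: ScalapinoWhiteZhang1993, §II] -/
theorem apply_le (hd : ThermalKTDictionaryZeemanAt tp U n h ρe Tc) {c : ℚ} (hleaf : ObsThermalStiffnessSeqCeilingZeemanAt tp U n c)
    {T : ℝ} (hT : 0 < T) (hTTc : T < Tc) : ρe T ≤ ((c : ℚ) : ℝ) :=
  (hd.thermal hT hTTc).le_of_leaf (one_div_pos.2 hT) (hd.apply_pos hT hTTc) hleaf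

/-- **Zeeman thermal stiffness ceiling ⇒ KT upper bound on `T_c` at field `h`, WITHOUT monotonicity**: `Tc ≤ (π/4)·c` (tree units).
[cite: HazraVermaRanderia2019, eqs. (2)–(3) and App. G] -/
theorem le_pi_div_four_mul (hd : ThermalKTDictionaryZeemanAt tp U n h ρe Tc) {c : ℚ}
    (hleaf : ObsThermalStiffnessSeqCeilingZeemanAt tp U n c) : Tc ≤ π / 4 * ((c : ℚ) : ℝ) :=
  le_pi_div_four_mul_of_pairTwistCeiling hd.stable hd.pos fun _ hT hTTc => hd.apply_le hleaf hT hTTc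

/-- **The family row at every Zeeman field, K3-free: `t′ = 0`, every `U`, every `0 ≤ n ≤ 2`, every `h`: `Tc ≤ 1/π`.**
[cite: HazraVermaRanderia2019, App. G] -/
theorem le_inv_pi_kinematic {U n h : ℝ} (hn0 : 0 ≤ n) (hn2 : n ≤ 2) {ρe : ℝ → ℝ} {Tc : ℝ}
    (hd : ThermalKTDictionaryZeemanAt 0 U n h ρe Tc) : Tc ≤ 1 / π := by
  have hπ : 0 < π := Real.pi_pos
  have hb : ∀ c : ℚ, 4 / π ^ 2 ≤ ((c : ℚ) : ℝ) → Tc ≤ π / 4 * ((c : ℚ) : ℝ) := fun c hc =>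
    hd.le_pi_div_four_mul (ObsThermalStiffnessSeqCeilingZeemanAt_tp0_kinematic hn0 hn2 c hc)
  refine le_of_forall_pos_lt_add fun ε hε => ?_
  have hεπ : 0 < ε / π := by positivity
  obtain ⟨c, hc1, hc2⟩ := exists_rat_btwn (show 4 / π ^ 2 < 4 / π ^ 2 + ε / π by linarith)
  have h1 := hb c hc1.le
  have h2 : π / 4 * ((c : ℚ) : ℝ) < π / 4 * (4 / π ^ 2 + ε / π) := mul_lt_mul_of_pos_left hc2 (by positivity)
  have h3 : π / 4 * (4 / π ^ 2 + ε / π) = 1 / π + ε / 4 := by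
    field_simp
  linarith

end ThermalKTDictionaryZeemanAt

end Summit.Ventures.CertifiedManyBodySolver.Observables

end
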